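import Mathlib

/-!
# Pair-sum annihilator `S`: non-vanishing, exact degree, root at `α + β`

For integer polynomials `P, Q ≠ 0` with complex roots `α` of `P` and `β` of `Q`, put
`S = C (lc(P_ℂ) ^ deg Q) * ∏_{a ∈ roots P_ℂ} Q_ℂ(X − a) ∈ ℂ[X]` (the image in `ℂ[X]` of the resultant
`Res_Y(P(Y), Q(X − Y))`, the classical integer annihilator of `α + β`).  We prove the three basic facts
used by the kernel hardness certificate for the naive Lindemann–Weierstrass layer of the crux
`DiophantineDichotomy.KhovanskiiApproxTypeEv` (line `Sketch`, stub `stub_pairSumBasic`):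
`S ≠ 0`, `deg S = deg P · deg Q`, and `S(α + β) = 0` (the factor at the root `a = α` is `Q_ℂ(X − α)`,
which vanishes at `α + β`).
-/

noncomputable section

set_option linter.dupNamespace false -- mandated summit/sub-problem namespace (single-conjunct summit)

namespace Summit.Schanuel.Schanuel.Cruxes.KhovanskiiApproxTypeEv.AnchoredReduction

open Polynomial

/-- A non-zero complex polynomial composed with the translation `X - C a` is non-zero. [folklore] -/
theorem comp_X_sub_C_ne_zero_of_ne_zero {q : ℂ[X]} (hq : q ≠ 0) (a : ℂ) :
    q.comp (X - C a) ≠ 0 := by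
  intro h
  rcases comp_eq_zero_iff.1 h with h1 | ⟨-, h2⟩
  · exact hq h1
  · have h3 := congrArg natDegree h2
    rw [natDegree_X_sub_C, natDegree_C] at h3
    exact one_ne_zero h3

/-- None of the translated factors `Q'(X - a)`, `a` a root of `P'`, is the zero polynomial. [folklore] -/
theorem zero_notMem_roots_map_comp (P' : ℂ[X]) {Q' : ℂ[X]} (hQ' : Q' ≠ 0) :
    (0 : ℂ[X]) ∉ P'.roots.map (fun a => Q'.comp (X - C a)) := by
  rw [Multiset.mem_map]
  rintro ⟨a, -, ha⟩
  exact comp_X_sub_C_ne_zero_of_ne_zero hQ' a ha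

/-- The pair-sum polynomial `C (lc P' ^ n) * ∏_{a ∈ roots P'} Q'(X - a)` is non-zero. [folklore] -/
theorem pairSumPoly_ne_zero {P' Q' : ℂ[X]} (hP' : P' ≠ 0) (hQ' : Q' ≠ 0) (n : ℕ) :
    C (P'.leadingCoeff ^ n) * (P'.roots.map (fun a => Q'.comp (X - C a))).prod ≠ 0 :=
  mul_ne_zero (C_ne_zero.2 (pow_ne_zero _ (leadingCoeff_ne_zero.2 hP')))
    (Multiset.prod_ne_zero (zero_notMem_roots_map_comp P' hQ'))

/-- The pair-sum polynomial has degree exactly `deg P' · deg Q'` (over `ℂ`, `P'` splits, so it has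
`deg P'` roots with multiplicity, and each factor `Q'(X - a)` has degree `deg Q'`). [folklore] -/
theorem pairSumPoly_natDegree {P' Q' : ℂ[X]} (hP' : P' ≠ 0) (hQ' : Q' ≠ 0) (n : ℕ) :
    (C (P'.leadingCoeff ^ n) * (P'.roots.map (fun a => Q'.comp (X - C a))).prod).natDegree =
      P'.natDegree * Q'.natDegree := by
  rw [natDegree_C_mul (pow_ne_zero _ (leadingCoeff_ne_zero.2 hP')),
    natDegree_multiset_prod _ (zero_notMem_roots_map_comp P' hQ'), Multiset.map_map]
  have h1 : P'.roots.map (natDegree ∘ fun a => Q'.comp (X - C a)) =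
      P'.roots.map (fun _ => Q'.natDegree) :=
    Multiset.map_congr rfl fun a _ => by
      simp only [Function.comp_apply, natDegree_comp, natDegree_X_sub_C, mul_one]
  rw [h1, Multiset.map_const', Multiset.sum_replicate, smul_eq_mul,
    IsAlgClosed.card_roots_eq_natDegree]

/-- The pair-sum polynomial vanishes at `α + β` whenever `P'(α) = 0` and `Q'(β) = 0`: the factor
`Q'(X - α)` of the product evaluates to `Q'(β) = 0`. [folklore] -/
theorem pairSumPoly_eval_add {P' Q' : ℂ[X]} (hP' : P' ≠ 0) (c : ℂ) {α β : ℂ} (hα : P'.eval α = 0)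
    (hβ : Q'.eval β = 0) :
    (C c * (P'.roots.map (fun a => Q'.comp (X - C a))).prod).eval (α + β) = 0 := by
  rw [eval_mul, eval_multiset_prod, Multiset.map_map]
  refine mul_eq_zero_of_right _ (Multiset.prod_eq_zero ?_)
  rw [Multiset.mem_map]
  refine ⟨α, (mem_roots hP').2 hα, ?_⟩
  simpa only [Function.comp_apply, eval_comp, eval_sub, eval_X, eval_C, add_sub_cancel_left] using hβ

/-- From `aeval z P = 0` for an integer polynomial `P` to a root of its image in `ℂ[X]`. [folklore] -/
theorem eval_map_intCastRingHom_eq_zero {P : ℤ[X]} {z : ℂ} (h : aeval z P = 0) :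
    (P.map (Int.castRingHom ℂ)).eval z = 0 := by
  rwa [eval_map, ← algebraMap_int_eq, ← aeval_def]

/-- **Basic facts about the pair-sum annihilator.**  For integer polynomials `P, Q ≠ 0` and complex
numbers `α, β` with `P(α) = 0`, `Q(β) = 0`, the complex polynomial
`S = C (lc(P_ℂ) ^ deg Q) * ∏_{a ∈ roots P_ℂ} Q_ℂ(X − a)` is non-zero, has degree exactly
`deg P · deg Q`, and satisfies `S(α + β) = 0`. [folklore] -/
theorem stub_pairSumBasic (P Q : Polynomial ℤ) (hP : P ≠ 0) (hQ : Q ≠ 0) (α β : ℂ)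
    (hα : Polynomial.aeval α P = 0) (hβ : Polynomial.aeval β Q = 0) :
    let S : Polynomial ℂ := Polynomial.C ((P.map (Int.castRingHom ℂ)).leadingCoeff ^ Q.natDegree) *
        ((P.map (Int.castRingHom ℂ)).roots.map
          (fun a => (Q.map (Int.castRingHom ℂ)).comp (Polynomial.X - Polynomial.C a))).prod
    S ≠ 0 ∧ S.natDegree = P.natDegree * Q.natDegree ∧ S.eval (α + β) = 0 := by
  intro S
  have hinj : Function.Injective (Int.castRingHom ℂ) := RingHom.injective_int _
  have hP' : P.map (Int.castRingHom ℂ) ≠ 0 := (Polynomial.map_ne_zero_iff hinj).2 hP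
  have hQ' : Q.map (Int.castRingHom ℂ) ≠ 0 := (Polynomial.map_ne_zero_iff hinj).2 hQ
  refine ⟨pairSumPoly_ne_zero hP' hQ' _, ?_, pairSumPoly_eval_add hP' _
    (eval_map_intCastRingHom_eq_zero hα) (eval_map_intCastRingHom_eq_zero hβ)⟩
  rw [← natDegree_map_eq_of_injective hinj P, ← natDegree_map_eq_of_injective hinj Q]
  exact pairSumPoly_natDegree hP' hQ' _

end Summit.Schanuel.Schanuel.Cruxes.KhovanskiiApproxTypeEv.AnchoredReduction

end
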